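import Literature.Geometry.Symplectic.SteinHandleProfileStart
import Literature.Geometry.Symplectic.SteinHandleProfilePieces
import Literature.Geometry.Symplectic.SteinHandleProfileWindows
import Mathlib.MeasureTheory.Integral.IntervalIntegral.FundThmCalculus
import Mathlib.MeasureTheory.Integral.IntervalIntegral.IntegrationByParts
import Mathlib.Analysis.SpecialFunctions.Log.Deriv
import Mathlib.Analysis.SpecialFunctions.Sqrt
import HarnessLib

/-!
# Assembling Eliashberg's handle profile, I: the glued second derivative and its integrals

Topic `Literature/Geometry/Symplectic`; proofs file of the fact seat of
`Literature.Geometry.Symplectic.Gompf1998_thm13_twoHandles` (**E2**, `SteinTwoHandles.lean`).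
Forstnerič–Kozak (2003), Prop. 3.1 (= Eliashberg 1990, Lemma 3.4.3) construct the profile
`u = f(t)` of the standard handlebody `K = {|x| ≤ f⁻¹(|y|)} ⊂ ℂ²` piecewise and then smooth.
Following the plan recorded in `SteinHandleProfileWindows.lean`, this file *defines* a
`C^∞` profile directly: its second derivative `φ` is the smooth-window convex combination of
the second derivatives of the four pieces — the logarithmically flat start
(`SteinHandleProfileStart.lean`), the descending law, the convex region and the quadric tail
(`SteinHandleProfilePieces.lean`) — plus a correction bump `β ψ` in the convex region, and
`f'`, `f` are obtained by integrating from a base point `t_L = 3σ/2` inside the exact start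
region ("left-anchored": there `f' = startSlope`, `f = startFn` *exactly*, so that the
inverse profile is the explicit `C^∞`-flat `startInv`).  Contents:

* §1 the constants of the construction as functions of the two parameters `λ > 1`, `ε > 0`
  (`HParam`): `A = (1 + λ)/2`, `g'(ε)`, `g''(ε)`, `c₀`, `η = c₀³/40`, `c₁`, `B`, `C = c₁⁻²`,
  `t₂ = η e^{-(C - 1/4)}`, `σ = t₂/2`, `t_L = 3σ/2` (Forstnerič–Kozak: `c`, `η`, `c₁`, `σ`);
* §2 the pieces `Q₀` (`= startSlope'`), `Q₂ = -descSlope³/(2t)`, `Q₁ = A + B(t - η)`,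
  `Q_g = λ/g³`, the bump `ψ`, and the glued second derivative `φ ω β`; smoothness of each on
  its domain and of `φ` on `(σ, ∞)` (`contDiffOn_phi`);
* §3 the slope `fp ω β t = startSlope(t_L) + ∫_{t_L}^t φ` and the profile
  `ff ω β r₀ t = startFn r₀ (t_L) + ∫_{t_L}^t fp`: derivatives (`hasDerivAt_fp`,
  `hasDerivAt_ff`), smoothness on `(σ, ∞)`, and **exactness on the start region**
  `σ < t ≤ 2σ(1 - ω)`: `fp = startSlope`, `ff = startFn r₀` (`fp_eq_P₀`, `ff_eq_startFn`).

The inequalities (3.2) for the assembled profile and the matching with the quadric for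
`t ≥ ε(1 + ω)` (choice of `β`, `r₀`) are the business of the sequel.  Everything is
**proved**; definitions only of the displayed objects, no named fact.

## References

* F. Forstnerič, J. Kozak, *Strongly pseudoconvex handlebodies*, J. Korean Math. Soc. 40
  (2003), 727–745 (arXiv:math/0305237), Prop. 3.1 and its proof. [ForstnericKozak2003]
* Ya. Eliashberg, *Topological characterization of Stein manifolds of dimension > 2*,
  Internat. J. Math. 1 (1990), 29–46, Lemma 3.4.3. [Eliashberg1990Stein]
-/

noncomputable section

open Set Filter MeasureTheory intervalIntegral
open scoped Topology ContDiff

namespace Literature.Geometry.Symplectic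

/-! ### §0 Two calculus helpers on an open half-line -/

/-- **FTC-1 on `(σ, ∞)`**: for `φ` continuous on `(σ, ∞)` and `a, t > σ`,
`u ↦ ∫_a^u φ` has derivative `φ(t)` at `t`. [folklore] -/
theorem hasDerivAt_integral_Ioi {φ : ℝ → ℝ} {σ a t : ℝ} (hφ : ContinuousOn φ (Ioi σ))
    (ha : σ < a) (ht : σ < t) : HasDerivAt (fun u => ∫ x in a..u, φ x) (φ t) t := by
  have hsub : uIcc a t ⊆ Ioi σ := fun x hx => by
    rcases le_total a t with h | h
    · rw [uIcc_of_le h] at hx; exact lt_of_lt_of_le ha hx.1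
    · rw [uIcc_of_ge h] at hx; exact lt_of_lt_of_le ht hx.1
  have hint : IntervalIntegrable φ volume a t := (hφ.mono hsub).intervalIntegrable
  have hmeas : StronglyMeasurableAtFilter φ (𝓝 t) volume :=
    ContinuousOn.stronglyMeasurableAtFilter isOpen_Ioi hφ t ht
  have hcont : ContinuousAt φ t := hφ.continuousAt (Ioi_mem_nhds ht)
  exact integral_hasDerivAt_right hint hmeas hcont

/-- **Smoothness of the primitive**: if `φ` is `C^∞` on `(σ, ∞)` then so is `u ↦ ∫_a^u φ`
(`a > σ`). [folklore] -/
theorem contDiffOn_integral_Ioi {φ : ℝ → ℝ} {σ a : ℝ} (hφ : ContDiffOn ℝ ∞ φ (Ioi σ))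
    (ha : σ < a) : ContDiffOn ℝ ∞ (fun u => ∫ x in a..u, φ x) (Ioi σ) := by
  have hd : ∀ t ∈ Ioi σ, HasDerivAt (fun u => ∫ x in a..u, φ x) (φ t) t := fun t ht =>
    hasDerivAt_integral_Ioi hφ.continuousOn ha ht
  rw [contDiffOn_infty_iff_deriv_of_isOpen isOpen_Ioi]
  refine ⟨fun t ht => (hd t ht).differentiableAt.differentiableWithinAt, ?_⟩
  exact hφ.congr fun t ht => (hd t ht).deriv

/-! ### §1 The constants -/

/-- The two free parameters of the construction: the quadric `λ > 1` and the width `ε > 0`.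
[cite: ForstnericKozak2003, Prop. 3.1] -/
structure HParam where
  /-- the parameter `λ` of the quadric domain `D_λ = {|y|² ≥ λ|x|² + 1}` -/
  l : ℝ
  /-- the width `ε`: the handlebody agrees with `D_λ` for `|x| ≥ ε(1 + ω)` -/
  ε : ℝ

namespace HParam

variable (P : HParam)

/-- `A = (1 + λ)/2`, the lower bound of `f''` in the convex region. [cite: ForstnericKozak2003, Prop. 3.1] -/
def A : ℝ := (1 + P.l) / 2
/-- `g(ε)`. [folklore] -/
def gε : ℝ := quadric P.l P.ε
/-- `g'(ε) = λε/g(ε)`. [folklore] -/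
def gpε : ℝ := P.l * P.ε / P.gε
/-- `g''(ε) = λ/g(ε)³`. [folklore] -/
def gppε : ℝ := P.l / P.gε ^ 3
/-- `c₀ = g'(ε) - ε (A + g''(ε))/2` (Forstnerič–Kozak's `c`, here `≈ (λ - 1)ε/4`). [cite: ForstnericKozak2003, Prop. 3.1] -/
def c₀ : ℝ := P.gpε - P.ε * (P.A + P.gppε) / 2
/-- `η = c₀³/40`. [cite: ForstnericKozak2003, Prop. 3.1] -/
def η : ℝ := P.c₀ ^ 3 / 40
/-- `c₁ = g'(ε) - (ε - η)(A + g''(ε))/2`, the slope at `t = η`. [cite: ForstnericKozak2003, Prop. 3.1] -/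
def c₁ : ℝ := P.gpε - (P.ε - P.η) * (P.A + P.gppε) / 2
/-- `B = (g''(ε) - A)/(ε - η)`, the slope of `f''` in the convex region. [folklore] -/
def B : ℝ := (P.gppε - P.A) / (P.ε - P.η)
/-- `C = c₁⁻²`, the constant of the descending law. [cite: ForstnericKozak2003, Prop. 3.1] -/
def Cc : ℝ := 1 / P.c₁ ^ 2
/-- `t₂ = η e^{-(C - 1/4)}`, the junction of the start piece with the descending law
(where `f' = 2`). [cite: ForstnericKozak2003, Prop. 3.1] -/
def t₂ : ℝ := P.η * Real.exp (-(P.Cc - 1 / 4))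
/-- `σ = t₂/2`, the radius of the tube around the core disc. [cite: ForstnericKozak2003, Prop. 3.1] -/
def σ : ℝ := P.t₂ / 2
/-- `t_L = 3σ/2`, the base point of the integrations (inside the exact start region).
[folklore] -/
def tL : ℝ := 3 * P.σ / 2

/-! ### §2 The pieces and the glued second derivative -/

/-- `Q₀ = startSlope'` (`L₀ = 6`), the second derivative on the start region. [cite: ForstnericKozak2003, Prop. 3.1] -/
def Q₀ (t : ℝ) : ℝ :=
  -(2 * P.σ * 6 ^ 2 / ((t - P.σ) ^ 2 * startLog P.σ 6 (t - P.σ) ^ 2)) *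
    (1 - 2 / startLog P.σ 6 (t - P.σ))
/-- `P₀ = startSlope` (`L₀ = 6`), the slope on the start region. [cite: ForstnericKozak2003, Prop. 3.1] -/
def P₀ (t : ℝ) : ℝ := startSlope P.σ 6 t
/-- `Q₂ = -descSlope³/(2t)`, the second derivative of the descending law. [cite: ForstnericKozak2003, Prop. 3.1] -/
def Q₂ (t : ℝ) : ℝ := -(descSlope P.Cc P.η t) ^ 3 / (2 * t)
/-- `Q₁ = A + B(t - η)`, the second derivative on the convex region. [cite: ForstnericKozak2003, Prop. 3.1] -/
def Q₁ (t : ℝ) : ℝ := P.A + P.B * (t - P.η)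
/-- `Q_g = g'' = λ/g³`, the second derivative of the quadric tail. [cite: ForstnericKozak2003, Example 2.4] -/
def Qg (t : ℝ) : ℝ := P.l / quadric P.l t ^ 3
/-- The correction bump `ψ`, supported in `[0.3ε, 0.55ε]`. [folklore] -/
def ψ (t : ℝ) : ℝ := window (P.ε / 3) (1 / 10) t * (1 - window (P.ε / 2) (1 / 10) t)

/-- **The glued second derivative** `φ = (1-χ₁)Q₀ + χ₁((1-χ₂)Q₂ + χ₂((1-χ₃)Q₁ + χ₃Q_g)) + βψ`
with windows `χ₁, χ₂, χ₃` at `t₂, η, ε` of relative half-width `ω`.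
[cite: ForstnericKozak2003, Prop. 3.1] -/
def φ (om β t : ℝ) : ℝ :=
  (1 - window P.t₂ om t) * P.Q₀ t +
      window P.t₂ om t *
        ((1 - window P.η om t) * P.Q₂ t +
          window P.η om t * ((1 - window P.ε om t) * P.Q₁ t + window P.ε om t * P.Qg t)) +
    β * P.ψ t

/-! #### Basic positivity of the constants -/

/-- The positivity hypotheses on the parameters used in this file. [folklore] -/
structure Pos : Prop where
  one_lt_l : 1 < P.l
  ε_pos : 0 < P.ε
  c₀_pos : 0 < P.c₀
  c₁_pos : 0 < P.c₁
  c₁_le : P.c₁ ≤ 1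
  η_lt : P.η < P.ε / 4

variable {P}

/-- `λ ≥ 0`. [folklore] -/
theorem Pos.l_nonneg (h : P.Pos) : 0 ≤ P.l := by linarith [h.one_lt_l]
/-- `η > 0`. [folklore] -/
theorem Pos.η_pos (h : P.Pos) : 0 < P.η := by
  have := h.c₀_pos; rw [η]; positivity
/-- `t₂ > 0`. [folklore] -/
theorem Pos.t₂_pos (h : P.Pos) : 0 < P.t₂ := by
  rw [t₂]; exact mul_pos h.η_pos (Real.exp_pos _)
/-- `σ > 0`. [folklore] -/
theorem Pos.σ_pos (h : P.Pos) : 0 < P.σ := by rw [σ]; linarith [h.t₂_pos]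
/-- `t₂ = 2σ`. [folklore] -/
theorem t₂_eq (P : HParam) : P.t₂ = 2 * P.σ := by rw [σ]; ring
/-- `t_L = 3σ/2`. [folklore] -/
theorem tL_eq (P : HParam) : P.tL = 3 * P.σ / 2 := rfl
/-- `σ < t_L`. [folklore] -/
theorem Pos.σ_lt_tL (h : P.Pos) : P.σ < P.tL := by rw [tL]; linarith [h.σ_pos]
/-- `t_L < 7σ/4`. [folklore] -/
theorem Pos.tL_lt (h : P.Pos) : P.tL < 7 * P.σ / 4 := by rw [tL]; linarith [h.σ_pos]

/-! #### Smoothness of the pieces -/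

/-- `t ↦ startLog σ 6 (t - σ) = 6 + log(σ/(t - σ))` is smooth on `(σ, ∞)`. [folklore] -/
theorem contDiffOn_startLog_comp (h : P.Pos) {n : ℕ∞} :
    ContDiffOn ℝ n (fun t => startLog P.σ 6 (t - P.σ)) (Ioi P.σ) := by
  have h1 : ContDiffOn ℝ n (fun t => P.σ / (t - P.σ)) (Ioi P.σ) :=
    contDiffOn_const.div (contDiffOn_id.sub contDiffOn_const) fun t ht => (sub_pos.2 ht).ne'
  have h2 : ContDiffOn ℝ n (fun t => Real.log (P.σ / (t - P.σ))) (Ioi P.σ) :=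
    h1.log fun t ht => (div_pos h.σ_pos (sub_pos.2 ht)).ne'
  exact contDiffOn_const.add h2

/-- `L(t - σ) ≥ 6 - log 2 > 0` for `σ < t < 3σ`. [folklore] -/
theorem startLog_pos_of_lt {t : ℝ} (ht : P.σ < t) (ht3 : t < 3 * P.σ) :
    0 < startLog P.σ 6 (t - P.σ) := by
  have hs : 0 < t - P.σ := by linarith
  rw [startLog]
  have h1 : Real.log (P.σ / (t - P.σ)) ≥ Real.log (1 / 2) := by
    apply Real.log_le_log (by norm_num)
    rw [div_le_div_iff₀ (by norm_num) hs]; linarith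
  have h2 : Real.log (1 / 2) = -Real.log 2 := by rw [one_div, Real.log_inv]
  have h3 : Real.log 2 ≤ 1 := by
    have := Real.log_le_sub_one_of_pos (by norm_num : (0:ℝ) < 2); linarith
  linarith

/-- `Q₀` is smooth on `(σ, 3σ)`. [folklore] -/
theorem contDiffOn_Q₀ (h : P.Pos) {n : ℕ∞} : ContDiffOn ℝ n P.Q₀ (Ioo P.σ (3 * P.σ)) := by
  have hL : ContDiffOn ℝ n (fun t => startLog P.σ 6 (t - P.σ)) (Ioo P.σ (3 * P.σ)) :=
    (contDiffOn_startLog_comp h).mono Ioo_subset_Ioi_self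
  have hL0 : ∀ t ∈ Ioo P.σ (3 * P.σ), startLog P.σ 6 (t - P.σ) ≠ 0 := fun t ht =>
    (startLog_pos_of_lt ht.1 ht.2).ne'
  have hD : ContDiffOn ℝ n (fun t => (t - P.σ) ^ 2 * startLog P.σ 6 (t - P.σ) ^ 2) (Ioo P.σ (3 * P.σ)) :=
    ((contDiffOn_id.sub contDiffOn_const).pow 2).mul (hL.pow 2)
  have hD0 : ∀ t ∈ Ioo P.σ (3 * P.σ), (t - P.σ) ^ 2 * startLog P.σ 6 (t - P.σ) ^ 2 ≠ 0 := fun t ht =>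
    mul_ne_zero (pow_ne_zero 2 (sub_pos.2 ht.1).ne') (pow_ne_zero 2 (hL0 t ht))
  refine ((contDiffOn_const.div hD hD0).neg).mul (contDiffOn_const.sub (contDiffOn_const.div hL hL0))

/-- `P₀ = startSlope` is smooth on `(σ, 3σ)`. [folklore] -/
theorem contDiffOn_P₀ (h : P.Pos) {n : ℕ∞} : ContDiffOn ℝ n P.P₀ (Ioo P.σ (3 * P.σ)) := by
  have hL : ContDiffOn ℝ n (fun t => startLog P.σ 6 (t - P.σ)) (Ioo P.σ (3 * P.σ)) :=
    (contDiffOn_startLog_comp h).mono Ioo_subset_Ioi_self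
  have hD : ContDiffOn ℝ n (fun t => (t - P.σ) * startLog P.σ 6 (t - P.σ) ^ 2) (Ioo P.σ (3 * P.σ)) :=
    (contDiffOn_id.sub contDiffOn_const).mul (hL.pow 2)
  have hD0 : ∀ t ∈ Ioo P.σ (3 * P.σ), (t - P.σ) * startLog P.σ 6 (t - P.σ) ^ 2 ≠ 0 := fun t ht =>
    mul_ne_zero (sub_pos.2 ht.1).ne' (pow_ne_zero 2 (startLog_pos_of_lt ht.1 ht.2).ne')
  show ContDiffOn ℝ n (fun t => startSlope P.σ 6 t) _
  simp only [startSlope]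
  exact contDiffOn_const.div hD hD0

/-- `P₀' = Q₀` on `(σ, 3σ)`. [cite: ForstnericKozak2003, Prop. 3.1] -/
theorem hasDerivAt_P₀ (h : P.Pos) {t : ℝ} (ht : P.σ < t) (ht3 : t < 3 * P.σ) :
    HasDerivAt P.P₀ (P.Q₀ t) t :=
  hasDerivAt_startSlope h.σ_pos ht (startLog_pos_of_lt ht ht3).ne'

/-- The domain of the descending law starts at `η e^{-C} = t₂ e^{-1/4} < (4/5) t₂`. [folklore] -/
theorem descDomain (h : P.Pos) {t : ℝ} (ht : 8 * P.σ / 5 < t) : 0 < P.Cc + Real.log (t / P.η) := by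
  have hη := h.η_pos
  have ht0 : 0 < t := lt_trans (by linarith [h.σ_pos]) ht
  -- `t/η > (4/5) e^{-(C - 1/4)}` and `log(4/5) > -1/4`
  have h1 : P.t₂ = 2 * P.σ := t₂_eq P
  have h2 : (4 / 5) * Real.exp (-(P.Cc - 1 / 4)) < t / P.η := by
    rw [lt_div_iff₀ hη]
    have : (4 / 5) * P.t₂ < t := by linarith
    calc (4 / 5) * Real.exp (-(P.Cc - 1 / 4)) * P.η = (4 / 5) * P.t₂ := by rw [t₂]; ring
      _ < t := this
  have h3 : Real.log ((4 / 5) * Real.exp (-(P.Cc - 1 / 4))) < Real.log (t / P.η) :=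
    Real.log_lt_log (by positivity) h2
  rw [Real.log_mul (by norm_num) (Real.exp_pos _).ne', Real.log_exp] at h3
  have h4 : -(1 / 4) < Real.log (4 / 5) := by
    have h5 : Real.log (4 / 5) = -Real.log (5 / 4) := by
      rw [← Real.log_inv]; norm_num
    have h6 : Real.log (5 / 4) < 1 / 4 := by
      have := Real.log_le_sub_one_of_pos (by norm_num : (0:ℝ) < 5 / 4)
      have h7 : Real.log (5 / 4) ≠ 5 / 4 - 1 := by
        intro h8
        have := Real.log_lt_sub_one_of_pos (by norm_num : (0:ℝ) < 5 / 4) (by norm_num)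
        linarith
      exact lt_of_le_of_ne (by linarith) (by intro h8; apply h7; linarith)
    linarith
  linarith

/-- `descSlope C η` is smooth on `(8σ/5, ∞)`. [folklore] -/
theorem contDiffOn_descSlope (h : P.Pos) {n : ℕ∞} :
    ContDiffOn ℝ n (descSlope P.Cc P.η) (Ioi (8 * P.σ / 5)) := by
  have hη := h.η_pos
  have hpos : ∀ t ∈ Ioi (8 * P.σ / 5), 0 < t := fun t ht => lt_trans (by linarith [h.σ_pos]) ht
  have h1 : ContDiffOn ℝ n (fun t => P.Cc + Real.log (t / P.η)) (Ioi (8 * P.σ / 5)) :=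
    contDiffOn_const.add ((contDiffOn_id.div_const _).log fun t ht => (div_pos (hpos t ht) hη).ne')
  have h2 : ContDiffOn ℝ n (fun t => Real.sqrt (P.Cc + Real.log (t / P.η))) (Ioi (8 * P.σ / 5)) :=
    h1.sqrt fun t ht => (descDomain h ht).ne'
  show ContDiffOn ℝ n (fun t => descSlope P.Cc P.η t) _
  simp only [descSlope]
  exact contDiffOn_const.div h2 fun t ht => (Real.sqrt_pos.2 (descDomain h ht)).ne'

/-- `Q₂` is smooth on `(8σ/5, ∞)`. [folklore] -/
theorem contDiffOn_Q₂ (h : P.Pos) {n : ℕ∞} : ContDiffOn ℝ n P.Q₂ (Ioi (8 * P.σ / 5)) := by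
  have hpos : ∀ t ∈ Ioi (8 * P.σ / 5), (2 : ℝ) * t ≠ 0 := fun t ht =>
    mul_ne_zero two_ne_zero (lt_trans (by linarith [h.σ_pos]) ht).ne'
  exact ((contDiffOn_descSlope h).pow 3).neg.div (contDiffOn_const.mul contDiffOn_id) hpos

/-- `Q₁` is smooth. [folklore] -/
theorem contDiff_Q₁ {n : ℕ∞} : ContDiff ℝ n P.Q₁ :=
  contDiff_const.add (contDiff_const.mul (contDiff_id.sub contDiff_const))

/-- `quadric λ` is smooth (`λ ≥ 0`). [folklore] -/
theorem contDiff_quadric {l : ℝ} (hl : 0 ≤ l) {n : ℕ∞} : ContDiff ℝ n (quadric l) := by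
  show ContDiff ℝ n fun t => Real.sqrt (l * t ^ 2 + 1)
  exact (contDiff_const.mul (contDiff_id.pow 2) |>.add contDiff_const).sqrt fun t => by positivity

/-- `Q_g` is smooth. [folklore] -/
theorem contDiff_Qg (h : P.Pos) {n : ℕ∞} : ContDiff ℝ n P.Qg :=
  contDiff_const.div ((contDiff_quadric h.l_nonneg).pow 3) fun t => (pow_pos (quadric_pos h.l_nonneg t) 3).ne'

/-- `ψ` is smooth. [folklore] -/
theorem contDiff_ψ {n : ℕ∞} : ContDiff ℝ n P.ψ :=
  contDiff_window.mul (contDiff_const.sub contDiff_window)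

/-- **`φ` is smooth on `(σ, ∞)`** (`0 < ω ≤ 1/8`): near each `t > σ` only smooth pieces are
switched on. [folklore] -/
theorem contDiffOn_phi (h : P.Pos) {om : ℝ} (hom : 0 < om) (hom8 : om ≤ 1 / 8) (β : ℝ) {n : ℕ∞} :
    ContDiffOn ℝ n (P.φ om β) (Ioi P.σ) := by
  have hσ := h.σ_pos
  have ht₂ : P.t₂ = 2 * P.σ := t₂_eq P
  have ht₂0 : 0 < P.t₂ := h.t₂_pos
  intro t ht
  have ht' : P.σ < t := ht
  -- the inner (right) part is smooth on `(8σ/5, ∞)`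
  set R : ℝ → ℝ := fun t => (1 - window P.η om t) * P.Q₂ t +
      window P.η om t * ((1 - window P.ε om t) * P.Q₁ t + window P.ε om t * P.Qg t) with hR
  have hRs : ContDiffOn ℝ n R (Ioi (8 * P.σ / 5)) := by
    refine ((contDiffOn_const.sub contDiff_window.contDiffOn).mul (contDiffOn_Q₂ h)).add
      (contDiff_window.contDiffOn.mul ?_)
    exact ((contDiffOn_const.sub contDiff_window.contDiffOn).mul contDiff_Q₁.contDiffOn).add
      (contDiff_window.contDiffOn.mul (contDiff_Qg h).contDiffOn)
  have hψ : ContDiffAt ℝ n (fun t => β * P.ψ t) t := (contDiff_const.mul contDiff_ψ).contDiffAt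
  by_cases h1 : t < 7 * P.σ / 4
  · -- left: `window t₂ ω = 0` near `t`, so `φ = Q₀ + βψ`
    have hw : window P.t₂ om =ᶠ[𝓝 t] fun _ => 0 :=
      window_eventuallyEq_zero ht₂0 hom (by rw [ht₂]; nlinarith)
    have hQ : ContDiffAt ℝ n P.Q₀ t :=
      (contDiffOn_Q₀ h).contDiffAt (Ioo_mem_nhds ht' (by linarith))
    have heq : P.φ om β =ᶠ[𝓝 t] fun t => P.Q₀ t + β * P.ψ t := by
      filter_upwards [hw] with t' ht'
      simp only [φ, ht']; ring
    exact ((hQ.add hψ).congr_of_eventuallyEq heq).contDiffWithinAt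
  · rw [not_lt] at h1
    have h85 : 8 * P.σ / 5 < t := by linarith
    have hRt : ContDiffAt ℝ n R t := hRs.contDiffAt (Ioi_mem_nhds h85)
    have hwin : ContDiffAt ℝ n (window P.t₂ om) t := contDiff_window.contDiffAt
    by_cases h2 : t < 3 * P.σ
    · -- middle: everything smooth near `t`
      have hQ : ContDiffAt ℝ n P.Q₀ t := (contDiffOn_Q₀ h).contDiffAt (Ioo_mem_nhds ht' h2)
      have : ContDiffAt ℝ n (fun t => (1 - window P.t₂ om t) * P.Q₀ t + window P.t₂ om t * R t + β * P.ψ t) t :=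
        (((contDiffAt_const.sub hwin).mul hQ).add (hwin.mul hRt)).add hψ
      exact this.contDiffWithinAt
    · -- right: `window t₂ ω = 1` near `t`, so `φ = R + βψ`
      rw [not_lt] at h2
      have hw : window P.t₂ om =ᶠ[𝓝 t] fun _ => 1 :=
        window_eventuallyEq_one ht₂0 hom (by rw [ht₂]; nlinarith)
      have heq : P.φ om β =ᶠ[𝓝 t] fun t => R t + β * P.ψ t := by
        filter_upwards [hw] with t' ht'
        simp only [φ, ht', hR]; ring
      exact ((hRt.add hψ).congr_of_eventuallyEq heq).contDiffWithinAt

/-! #### Sizes: `t₂ ≤ η`, so `σ < η/2 < ε/8` -/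

/-- `C ≥ 1` (as `0 < c₁ ≤ 1`). [folklore] -/
theorem Pos.one_le_Cc (h : P.Pos) : 1 ≤ P.Cc := by
  rw [Cc, le_div_iff₀ (pow_pos h.c₁_pos 2)]
  nlinarith [h.c₁_pos, h.c₁_le]

/-- `t₂ ≤ η`. [folklore] -/
theorem Pos.t₂_le_η (h : P.Pos) : P.t₂ ≤ P.η := by
  rw [t₂]
  have : Real.exp (-(P.Cc - 1 / 4)) ≤ 1 := Real.exp_le_one_iff.2 (by linarith [h.one_le_Cc])
  exact (mul_le_mul_of_nonneg_left this h.η_pos.le).trans (by rw [mul_one])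

/-- `σ < ε/8`. [folklore] -/
theorem Pos.σ_lt_ε (h : P.Pos) : P.σ < P.ε / 8 := by
  have h1 := h.t₂_le_η; have h2 := h.η_lt; rw [σ]; linarith

/-- `ψ = 0` on `t ≤ 3ε/10`. [folklore] -/
theorem ψ_zero_of_le (h : P.Pos) {t : ℝ} (ht : t ≤ 3 * P.ε / 10) : P.ψ t = 0 := by
  rw [ψ, window_zero_of_le (by linarith [h.ε_pos]) (by norm_num) (by linarith), zero_mul]

/-- **On the start region `φ = Q₀`**: for `t ≤ t₂(1 - ω)` (`0 < ω`) all windows and the bump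
vanish. [cite: ForstnericKozak2003, Prop. 3.1] -/
theorem φ_eq_Q₀ (h : P.Pos) {om : ℝ} (hom : 0 < om) (β : ℝ) {t : ℝ} (ht : t ≤ P.t₂ * (1 - om)) :
    P.φ om β t = P.Q₀ t := by
  have ht₂ := h.t₂_pos
  have hw : window P.t₂ om t = 0 := window_zero_of_le ht₂ hom ht
  have ht' : t ≤ 3 * P.ε / 10 := by
    have h1 : P.t₂ * (1 - om) ≤ P.t₂ := by nlinarith
    have h2 := h.t₂_le_η; have h3 := h.η_lt; linarith
  rw [φ, hw, ψ_zero_of_le h ht']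
  ring

/-! ### §3 The slope and the profile: integrals from the base point `t_L` -/

/-- **The slope** `f'(t) = startSlope(t_L) + ∫_{t_L}^t φ`. [cite: ForstnericKozak2003, Prop. 3.1] -/
def fp (om β t : ℝ) : ℝ := P.P₀ P.tL + ∫ x in P.tL..t, P.φ om β x

/-- **The profile** `f(t) = startFn r₀ (t_L) + ∫_{t_L}^t f'`. [cite: ForstnericKozak2003, Prop. 3.1] -/
def ff (om β r₀ t : ℝ) : ℝ := startFn P.σ 6 r₀ P.tL + ∫ x in P.tL..t, P.fp om β x

/-- `f'` has derivative `φ` on `(σ, ∞)`. [folklore] -/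
theorem hasDerivAt_fp (h : P.Pos) {om : ℝ} (hom : 0 < om) (hom8 : om ≤ 1 / 8) (β : ℝ) {t : ℝ}
    (ht : P.σ < t) : HasDerivAt (P.fp om β) (P.φ om β t) t := by
  have := (hasDerivAt_integral_Ioi (contDiffOn_phi h hom hom8 β (n := ⊤)).continuousOn h.σ_lt_tL ht).const_add
    (P.P₀ P.tL)
  exact this

/-- `f'` is smooth on `(σ, ∞)`. [folklore] -/
theorem contDiffOn_fp (h : P.Pos) {om : ℝ} (hom : 0 < om) (hom8 : om ≤ 1 / 8) (β : ℝ) :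
    ContDiffOn ℝ ∞ (P.fp om β) (Ioi P.σ) :=
  contDiffOn_const.add (contDiffOn_integral_Ioi (contDiffOn_phi h hom hom8 β) h.σ_lt_tL)

/-- `f` has derivative `f'` on `(σ, ∞)`. [folklore] -/
theorem hasDerivAt_ff (h : P.Pos) {om : ℝ} (hom : 0 < om) (hom8 : om ≤ 1 / 8) (β r₀ : ℝ) {t : ℝ}
    (ht : P.σ < t) : HasDerivAt (P.ff om β r₀) (P.fp om β t) t :=
  (hasDerivAt_integral_Ioi (contDiffOn_fp h hom hom8 β).continuousOn h.σ_lt_tL ht).const_add _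

/-- `f` is smooth on `(σ, ∞)`. [folklore] -/
theorem contDiffOn_ff (h : P.Pos) {om : ℝ} (hom : 0 < om) (hom8 : om ≤ 1 / 8) (β r₀ : ℝ) :
    ContDiffOn ℝ ∞ (P.ff om β r₀) (Ioi P.σ) :=
  contDiffOn_const.add (contDiffOn_integral_Ioi (contDiffOn_fp h hom hom8 β) h.σ_lt_tL)

/-- The interval between the base point and a point of the start region lies in `(σ, t₂(1-ω)]`
(`ω ≤ 1/8`). [folklore] -/
theorem uIcc_tL_subset (h : P.Pos) {om : ℝ} (hom8 : om ≤ 1 / 8) {t : ℝ} (ht : P.σ < t)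
    (ht2 : t ≤ P.t₂ * (1 - om)) : uIcc P.tL t ⊆ Ioc P.σ (P.t₂ * (1 - om)) := by
  have hσ := h.σ_pos
  have htL1 : P.σ < P.tL := h.σ_lt_tL
  have htL2 : P.tL ≤ P.t₂ * (1 - om) := by rw [tL, t₂_eq]; nlinarith
  intro x hx
  rcases le_total P.tL t with hle | hle
  · rw [uIcc_of_le hle] at hx; exact ⟨lt_of_lt_of_le htL1 hx.1, hx.2.trans ht2⟩
  · rw [uIcc_of_ge hle] at hx; exact ⟨lt_of_lt_of_le ht hx.1, hx.2.trans htL2⟩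

/-- **Exactness of the slope on the start region**: `f' = startSlope` for
`σ < t ≤ t₂(1 - ω)` (`0 < ω ≤ 1/8`). [cite: ForstnericKozak2003, Prop. 3.1] -/
theorem fp_eq_P₀ (h : P.Pos) {om : ℝ} (hom : 0 < om) (hom8 : om ≤ 1 / 8) (β : ℝ) {t : ℝ}
    (ht : P.σ < t) (ht2 : t ≤ P.t₂ * (1 - om)) : P.fp om β t = P.P₀ t := by
  have hsub := uIcc_tL_subset h hom8 ht ht2
  have h3σ : ∀ x ∈ uIcc P.tL t, P.σ < x ∧ x < 3 * P.σ := fun x hx => by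
    have h1 := hsub hx
    refine ⟨h1.1, lt_of_le_of_lt h1.2 ?_⟩
    rw [t₂_eq]; nlinarith [h.σ_pos]
  have hcongr : ∫ x in P.tL..t, P.φ om β x = ∫ x in P.tL..t, P.Q₀ x :=
    integral_congr fun x hx => φ_eq_Q₀ h hom β (hsub hx).2
  have hderiv : ∀ x ∈ uIcc P.tL t, HasDerivAt P.P₀ (P.Q₀ x) x := fun x hx =>
    hasDerivAt_P₀ h (h3σ x hx).1 (h3σ x hx).2
  have hint : IntervalIntegrable P.Q₀ volume P.tL t := by
    refine ((contDiffOn_Q₀ h (n := ⊤)).continuousOn.mono ?_).intervalIntegrable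
    exact fun x hx => ⟨(h3σ x hx).1, (h3σ x hx).2⟩
  rw [fp, hcongr, integral_eq_sub_of_hasDerivAt hderiv hint]
  ring

/-- **Exactness of the profile on the start region**: `f = startFn r₀` for
`σ < t ≤ t₂(1 - ω)`. [cite: ForstnericKozak2003, Prop. 3.1] -/
theorem ff_eq_startFn (h : P.Pos) {om : ℝ} (hom : 0 < om) (hom8 : om ≤ 1 / 8) (β r₀ : ℝ) {t : ℝ}
    (ht : P.σ < t) (ht2 : t ≤ P.t₂ * (1 - om)) : P.ff om β r₀ t = startFn P.σ 6 r₀ t := by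
  have hsub := uIcc_tL_subset h hom8 ht ht2
  have h3σ : ∀ x ∈ uIcc P.tL t, P.σ < x ∧ x < 3 * P.σ := fun x hx => by
    have h1 := hsub hx
    refine ⟨h1.1, lt_of_le_of_lt h1.2 ?_⟩
    rw [t₂_eq]; nlinarith [h.σ_pos]
  have hcongr : ∫ x in P.tL..t, P.fp om β x = ∫ x in P.tL..t, P.P₀ x :=
    integral_congr fun x hx => fp_eq_P₀ h hom hom8 β (hsub hx).1 (hsub hx).2
  have hderiv : ∀ x ∈ uIcc P.tL t, HasDerivAt (startFn P.σ 6 r₀) (P.P₀ x) x := fun x hx =>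
    hasDerivAt_startFn h.σ_pos (h3σ x hx).1 (startLog_pos_of_lt (h3σ x hx).1 (h3σ x hx).2).ne'
  have hint : IntervalIntegrable P.P₀ volume P.tL t := by
    refine ((contDiffOn_P₀ h (n := ⊤)).continuousOn.mono ?_).intervalIntegrable
    exact fun x hx => ⟨(h3σ x hx).1, (h3σ x hx).2⟩
  rw [ff, hcongr, integral_eq_sub_of_hasDerivAt hderiv hint]
  ring

end HParam

end Literature.Geometry.Symplectic

end
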